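import Summits.Ventures.Crystal3D.Theorems.StickyWulffConstantPolycrystalWulffBoundTwoClassReduction
import Summits.Ventures.Crystal3D.Theorems.StickyWulffConstantPolycrystalWulffBoundVerticalLamellarChimera
import Summits.Ventures.Crystal3D.Theorems.StickyWulffConstantPolycrystalWulffBoundInclinedLamellarTextureAxis

/-!
# `PolycrystalWulffBound`, line `PolyDensity`: `rung_singleAxis_of_twoGrain` — the SINGLE-AXIS case of
# the crux, in the crux's own vocabulary, follows from the TWO-GRAIN (two-phase) twin inequality
# (crux `stmt-Ventures-19482`; memo P-L2-g15 §5(7))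

Route `StickyWulffConstant` of the venture `Summits/Ventures/Crystal3D`, second prover lane (poly-p2,
gen 15).  For a crux texture `Tex n G A c m` with POLYHEDRAL grains whose frames are pairwise co-axial
about one axis `m₀` (`Ax m₀ (A f) (A g)` for all `f, g` — the single-axis class of the P map: basal /
vertical / inclined twin walls, translation domains, any cycles), the energy bound
`6·2^{1/3}(√2·Vol)^{2/3} ≤ En n G A c m` follows from the same bound for TWO-GRAIN textures `(S₁, S₂)`
with bodies `W(A f₀)` and its basal mirror image `(ℝ∙m₀)ᗮ.reflection '' W(A f₀)`, kernel `Dsc m₀` and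
charge `½` (the hypothesis, quantified over a base grain `f₀` and polyhedral `S₁, S₂`).  INGREDIENTS:
co-axial frames carry the body of the base grain or its mirror image
(`cruxWulffBody_eq_or_eq_reflection_image`); the co-axial axis of two distinct lattices is unique up to
sign (`coaxial_axis_eq_or_eq_neg`), so every cross-class kernel is `Dsc m₀`; `Tex` charges cross-class
(distinct-lattice) pairs `≥ ½` and all pairs `≥ 0`; equal lattices have equal bodies
(`wulffBody_eq_of_image_eq`); then `polyBound_of_twoGrain` (`…TwoClassReduction`).
READING: the single-axis residual of §87.4 is by name ONE two-grain statement.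
WHAT THIS IS NOT: the two-grain inequality; the crux is not claimed.
-/

noncomputable section

open scoped BigOperators InnerProductSpace ENNReal Pointwise
open MeasureTheory Filter Set

namespace Summit.Ventures.Crystal3D.Cruxes.PolycrystalWulffBound.PolyDensity

open Summit.Ventures.Crystal3D.Theorems
open Summit.Ventures.Crystal3D.Cruxes.TextureLiminf.TexShadow (per polytope facetArea E3)
open Literature.MathematicalPhysics.StatisticalMechanics (fccStacking barlowStacking IsHaggSeq perimeter)

/-- **Rung `rung_singleAxis_of_twoGrain`**: see the module docstring. -/
theorem rung_singleAxis_of_twoGrain :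
    let Λ : Set (EuclideanSpace ℝ (Fin 3)) := Literature.MathematicalPhysics.StatisticalMechanics.fccStacking 1 (Real.sqrt (2 / 3));
    let Brl : (ℤ → ℤ) → Set (EuclideanSpace ℝ (Fin 3)) := Literature.MathematicalPhysics.StatisticalMechanics.barlowStacking 1 (Real.sqrt (2 / 3));
    let Ax : EuclideanSpace ℝ (Fin 3) → (EuclideanSpace ℝ (Fin 3) ≃ₗᵢ[ℝ] EuclideanSpace ℝ (Fin 3)) → (EuclideanSpace ℝ (Fin 3) ≃ₗᵢ[ℝ] EuclideanSpace ℝ (Fin 3)) → Prop := fun m A B => ∃ (L : EuclideanSpace ℝ (Fin 3) ≃ₗᵢ[ℝ] EuclideanSpace ℝ (Fin 3)) (s₁ s₂ : EuclideanSpace ℝ (Fin 3)) (σ σ' : ℤ → ℤ), Literature.MathematicalPhysics.StatisticalMechanics.IsHaggSeq σ ∧ Literature.MathematicalPhysics.StatisticalMechanics.IsHaggSeq σ' ∧ L (EuclideanSpace.single (2 : Fin 3) (1 : ℝ)) = m ∧ A '' Λ ⊆ (fun q => L q + s₁) '' Brl σ ∧ B '' Λ ⊆ (fun q => L q + s₂)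 '' Brl σ';
    let CoAx : (EuclideanSpace ℝ (Fin 3) ≃ₗᵢ[ℝ] EuclideanSpace ℝ (Fin 3)) → (EuclideanSpace ℝ (Fin 3) ≃ₗᵢ[ℝ] EuclideanSpace ℝ (Fin 3)) → Prop := fun A B => ∃ m, Ax m A B;
    let Φ : EuclideanSpace ℝ (Fin 3) → ℝ := fun ν => Real.sqrt 2 / 4 * ∑ᶠ w ∈ {w ∈ Λ | ‖w‖ = 1}, |⟪w, ν⟫_ℝ|;
    let Per : Set (EuclideanSpace ℝ (Fin 3)) → Set (EuclideanSpace ℝ (Fin 3)) → ℝ := fun K S => (⨆ (ξ : EuclideanSpace ℝ (Fin 3) → EuclideanSpace ℝ (Fin 3)) (_ : ContDiff ℝ 1 ξ ∧ HasCompactSupport ξ ∧ ∀ z, ξ z ∈ K), ENNReal.ofReal (∫ z in S, Literature.MathematicalPhysics.StatisticalMechanics.fieldDivergence ξ z)).toReal;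
    let ι : Set (EuclideanSpace ℝ (Fin 3)) → Set (EuclideanSpace ℝ (Fin 3)) → Set (EuclideanSpace ℝ (Fin 3)) → ℝ := fun K S₁ S₂ => (Per K S₁ + Per K S₂ - Per K (S₁ ∪ S₂)) / 2;
    let W : (EuclideanSpace ℝ (Fin 3) ≃ₗᵢ[ℝ] EuclideanSpace ℝ (Fin 3)) → Set (EuclideanSpace ℝ (Fin 3)) := fun A => {y | ∀ ν : EuclideanSpace ℝ (Fin 3), ⟪y, ν⟫_ℝ ≤ Φ (A.symm ν)};
    let Dsc : EuclideanSpace ℝ (Fin 3) → Set (EuclideanSpace ℝ (Fin 3)) := fun m => {y | ‖y‖ ≤ 1 ∧ ⟪y, m⟫_ℝ = 0};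
    let Tex : (n : ℕ) → (Fin n → Set (EuclideanSpace ℝ (Fin 3))) → (Fin n → (EuclideanSpace ℝ (Fin 3) ≃ₗᵢ[ℝ] EuclideanSpace ℝ (Fin 3))) → (Fin n → Fin n → ℝ) → (Fin n → Fin n → EuclideanSpace ℝ (Fin 3)) → Prop := fun n G A c m => (∀ f : Fin n, Literature.MathematicalPhysics.StatisticalMechanics.HasFinitePerimeter (G f) ∧ volume (G f) < ⊤) ∧ (∀ f g, f ≠ g → Disjoint (G f) (G g)) ∧ (∀ f g, f ≠ g → 0 ≤ c f g) ∧ (∀ f g, f ≠ g → ¬ CoAx (A f) (A g) → m f g = 0 ∧ 1 ≤ c f g) ∧ (∀ f g, f ≠ g → CoAx (A f) (A g) → A f '' Λ ≠ A g '' Λ → Ax (m f g) (A f) (A g) ∧ 1 / 2 ≤ c f g);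
    let En : (n : ℕ) → (Fin n → Set (EuclideanSpace ℝ (Fin 3))) → (Fin n → (EuclideanSpace ℝ (Fin 3) ≃ₗᵢ[ℝ] EuclideanSpace ℝ (Fin 3))) → (Fin n → Fin n → ℝ) → (Fin n → Fin n → EuclideanSpace ℝ (Fin 3)) → ℝ := fun n G A c m => ∑ f : Fin n, Per (W (A f)) (G f) - ∑ f, ∑ g, (if f = g then 0 else ι (W (A f)) (G f) (G g)) + ∑ f, ∑ g, (if f = g then 0 else c f g / 2 * ι (Dsc (m f g)) (G f) (G g));
    let Vol : (n : ℕ) → (Fin n → Set (EuclideanSpace ℝ (Fin 3))) → ℝ := fun n G => (volume (⋃ f : Fin n, G f)).toReal;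
    let Poly : Set (EuclideanSpace ℝ (Fin 3)) → Prop := fun S => ∃ (k : ℕ) (H : Fin k → Finset ((EuclideanSpace ℝ (Fin 3)) × ℝ)), S = ⋃ i, ⋂ p ∈ H i, {x | ⟪p.1, x⟫_ℝ < p.2};
    ∀ (n : ℕ) (G : Fin n → Set (EuclideanSpace ℝ (Fin 3)))
      (A : Fin n → (EuclideanSpace ℝ (Fin 3) ≃ₗᵢ[ℝ] EuclideanSpace ℝ (Fin 3)))
      (c : Fin n → Fin n → ℝ) (mm : Fin n → Fin n → EuclideanSpace ℝ (Fin 3)) (m₀ : EuclideanSpace ℝ (Fin 3)),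
      Tex n G A c mm → (∀ f, Poly (G f)) → (∀ f g, Ax m₀ (A f) (A g)) →
      (∀ (f₀ : Fin n) (S₁ S₂ : Set (EuclideanSpace ℝ (Fin 3))), Poly S₁ → Poly S₂ →
          volume S₁ < ⊤ → volume S₂ < ⊤ → Disjoint S₁ S₂ →
        6 * (2 : ℝ) ^ ((1 : ℝ) / 3) * (Real.sqrt 2 * (volume (S₁ ∪ S₂)).toReal) ^ ((2 : ℝ) / 3) ≤
          (Per (W (A f₀)) S₁ - ι (W (A f₀)) S₁ S₂) +
          (Per ((ℝ ∙ m₀)ᗮ.reflection '' W (A f₀)) S₂ - ι ((ℝ ∙ m₀)ᗮ.reflection '' W (A f₀)) S₂ S₁) +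
          1 / 2 * ι (Dsc m₀) S₁ S₂) →
      6 * (2 : ℝ) ^ ((1 : ℝ) / 3) * (Real.sqrt 2 * Vol n G) ^ ((2 : ℝ) / 3) ≤ En n G A c mm := by
  intro Λ Brl Ax CoAx Φ Per ι W Dsc Tex En Vol Poly n G A c mm m₀ hTex hPoly hAx H2
  classical
  obtain ⟨hfin, hdisjG, hc0, -, hcoax⟩ := hTex
  have hvol : ∀ f, volume (G f) < ⊤ := fun f => (hfin f).2
  rcases Nat.eq_zero_or_pos n with hn | hn
  · subst hn
    show 6 * (2 : ℝ) ^ ((1 : ℝ) / 3) * (Real.sqrt 2 * (volume (⋃ f : Fin 0, G f)).toReal) ^ ((2 : ℝ) / 3) ≤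
      ∑ f : Fin 0, Per (W (A f)) (G f) - ∑ f : Fin 0, ∑ g, (if f = g then 0 else ι (W (A f)) (G f) (G g)) +
        ∑ f : Fin 0, ∑ g, (if f = g then 0 else c f g / 2 * ι (Dsc (mm f g)) (G f) (G g))
    rw [iUnion_of_empty, measure_empty, ENNReal.toReal_zero, mul_zero, Real.zero_rpow (by norm_num),
      mul_zero]
    simp
  set f₀ : Fin n := ⟨0, hn⟩ with hf₀
  set R : E3 ≃ₗᵢ[ℝ] E3 := (ℝ ∙ m₀)ᗮ.reflection with hR
  set W₁ : Set E3 := W (A f₀) with hW₁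
  set W₂ : Set E3 := R '' W₁ with hW₂
  -- every grain carries `W₁` or `W₂`
  have hbody : ∀ f, W (A f) = W₁ ∨ W (A f) = W₂ := fun f =>
    cruxWulffBody_eq_or_eq_reflection_image (hAx f₀ f)
  set cls : Fin n → Bool := fun f => decide (W (A f) = W₁) with hcls
  have hWcls : ∀ f, W (A f) = if cls f then W₁ else W₂ := by
    intro f
    by_cases h : W (A f) = W₁
    · have : cls f = true := by simp [hcls, h]
      rw [this, if_pos rfl, h]
    · have : cls f = false := by simp [hcls, h]
      rw [this]
      simp only [Bool.false_eq_true, if_false]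
      exact (hbody f).resolve_left h
  -- the two bodies and the disc kernel are admissible
  have hW₁c : IsCompact W₁ := isCompact_cruxWulffBody (A f₀)
  have hW₁v : Convex ℝ W₁ := convex_cruxWulffBody (A f₀)
  have hW₁0 : (0 : E3) ∈ W₁ := zero_mem_cruxWulffBody (A f₀)
  have hW₁s : -W₁ = W₁ := neg_cruxWulffBody_eq (A f₀)
  have hW₂c : IsCompact W₂ := hW₁c.image R.continuous
  have hW₂v : Convex ℝ W₂ := hW₁v.linear_image R.toLinearEquiv.toLinearMap
  have hW₂0 : (0 : E3) ∈ W₂ := ⟨0, hW₁0, map_zero R⟩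
  have hW₂s : -W₂ = W₂ := by
    ext y
    simp only [Set.mem_neg, hW₂, mem_image]
    constructor
    · rintro ⟨x, hx, hxy⟩
      refine ⟨-x, by rw [← hW₁s]; simpa using hx, ?_⟩
      rw [map_neg, hxy, neg_neg]
    · rintro ⟨x, hx, rfl⟩
      refine ⟨-x, by rw [← hW₁s]; simpa using hx, ?_⟩
      rw [map_neg]
  have hDc : ∀ v : E3, IsCompact (Dsc v) := fun v =>
    Metric.isCompact_of_isClosed_isBounded
      ((isClosed_le continuous_norm continuous_const).inter
        (isClosed_eq (continuous_id.inner continuous_const) continuous_const))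
      (Metric.isBounded_closedBall.subset (cruxDisc_subset_closedBall v))
  have hDv : ∀ v : E3, Convex ℝ (Dsc v) := fun v => convex_cruxDisc v
  have hD0 : ∀ v : E3, (0 : E3) ∈ Dsc v := fun v => zero_mem_cruxDisc v
  have hDs : -Dsc m₀ = Dsc m₀ := by
    ext y
    show -y ∈ {y : E3 | ‖y‖ ≤ 1 ∧ ⟪y, m₀⟫_ℝ = 0} ↔ y ∈ {y : E3 | ‖y‖ ≤ 1 ∧ ⟪y, m₀⟫_ℝ = 0}
    simp only [mem_setOf_eq, norm_neg, inner_neg_left, neg_eq_zero]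
  have hDneg : ∀ v : E3, Dsc (-v) = Dsc v := by
    intro v; ext y
    show y ∈ {y : E3 | ‖y‖ ≤ 1 ∧ ⟪y, -v⟫_ℝ = 0} ↔ y ∈ {y : E3 | ‖y‖ ≤ 1 ∧ ⟪y, v⟫_ℝ = 0}
    simp only [mem_setOf_eq, inner_neg_right, neg_eq_zero]
  -- cross-class pairs: distinct lattices, hence charge `≥ ½` and kernel `Dsc m₀`
  have hne : ∀ f g, cls f ≠ cls g → A f '' Λ ≠ A g '' Λ := by
    intro f g hfg hΛ
    have hWeq : W (A f) = W (A g) := wulffBody_eq_of_image_eq hΛ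
    apply hfg
    simp only [hcls, hWeq]
  have hcc : ∀ f g, cls f ≠ cls g → Ax (mm f g) (A f) (A g) ∧ 1 / 2 ≤ c f g := by
    intro f g hfg
    have hfg' : f ≠ g := fun h => hfg (by rw [h])
    exact hcoax f g hfg' ⟨m₀, hAx f g⟩ (hne f g hfg)
  have hDD₀ : ∀ f g, cls f ≠ cls g → Dsc (mm f g) = Dsc m₀ := by
    intro f g hfg
    rcases coaxial_axis_eq_or_eq_neg (hcc f g hfg).1 (hAx f g) (hne f g hfg) with h | h
    · rw [h]
    · rw [h, hDneg]
  -- the reduction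
  have hmain := polyBound_of_twoGrain W₁ W₂ (Dsc m₀) hW₁c hW₁v hW₁0 hW₁s hW₂c hW₂v hW₂0 hW₂s
    (hDc m₀) (hDv m₀) (hD0 m₀) hDs (1 / 2) (H2 f₀) G hPoly hvol hdisjG cls (fun f g => Dsc (mm f g))
    (fun f g => hDc (mm f g)) (fun f g => hDv (mm f g)) (fun f g => hD0 (mm f g)) hDD₀ c hc0
    (fun f g hfg => (hcc f g hfg).2)
  have hite : ∀ f, (if cls f then W₁ else W₂) = W (A f) := fun f => (hWcls f).symm
  simp only [hite] at hmain
  show 6 * (2 : ℝ) ^ ((1 : ℝ) / 3) * (Real.sqrt 2 * (volume (⋃ f, G f)).toReal) ^ ((2 : ℝ) / 3) ≤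
    (∑ f, Per (W (A f)) (G f)) - (∑ f, ∑ g, (if f = g then 0 else ι (W (A f)) (G f) (G g))) +
      ∑ f, ∑ g, (if f = g then 0 else c f g / 2 * ι (Dsc (mm f g)) (G f) (G g))
  rw [← Finset.sum_sub_distrib]
  exact hmain

end Summit.Ventures.Crystal3D.Cruxes.PolycrystalWulffBound.PolyDensity

end
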